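import Literature.NumberTheory.EllipticCurves.BSDRootNumberOddParityProofs
import Literature.NumberTheory.EllipticCurves.ModularityVersionAp
import Literature.NumberTheory.DiophantineGeometry.LocalReductionFiniteBadPlacesProofs
import Mathlib.NumberTheory.SumPrimeReciprocals
import HarnessLib

/-!
# The no-continuation branch of the parity fact bsd.S36 (proofs for
`Literature.NumberTheory.EllipticCurves.BSDRootNumber`)

Third proof file of the named fact
`Literature.NumberTheory.EllipticCurves.even_analyticRank_iff_rootNumber_eq_one W`
(`∀ [W.IsElliptic], Even W.analyticRank ↔ W.rootNumber = 1`; Silverman, *AEC*, C.16, Thm. 16.3 and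
the remark following it, p. 451), after `BSDRootNumberProofs` (everything downstream of the
functional equation) and `BSDRootNumberOddParityProofs` (the implication `Even r_an → w = 1` and the
reduction of the fact to `w = 1 → Even r_an`).

The tree's analytic rank `W.analyticRank = analyticOrderNatAt W.entireLFunction 1` is built on the
classically chosen entire continuation `W.entireLFunction` of Mathlib's `L`-series `W.LSeries`,
whose **documented junk value**, when no entire continuation exists (`¬ W.HasEntireLFunction`), is
the series `W.LSeries = LSeries (aₙ(W))` itself (`Literature.NumberTheory.EllipticCurves.AnalyticRank`).
This file disposes of that junk branch **unconditionally**: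

* `WeierstrassCurve.not_LSeriesSummable_LFunction_one`: for an elliptic `W / ℚ` the Dirichlet
  series `∑ aₙ(W) n⁻ˢ` does **not** converge absolutely at `s = 1` (so its abscissa of absolute
  convergence is `≥ 1`, `one_le_abscissaOfAbsConv_LFunction`; the truth is `3/2`). Proof: at a prime
  `p` of good reduction `a_{p²} = a_p² − p` (`LFunction_apply_prime_sq_of_hasGoodReductionAt`, from
  the tree's prime-power recursion `WeierstrassCurve.LFunction_apply_prime_pow_add_two`,
  Diamond–Shurman (8.44)), and `a_p ∈ ℤ`, so either `a_p = 0` and `|a_{p²}|/p² = 1/p`, or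
  `|a_p| ≥ 1` and `|a_p|/p ≥ 1/p`; all but finitely many primes are good
  (`WeierstrassCurve.finite_badPlaces_holds`, Silverman Rem. VIII.1.3), and `∑ 1/p` diverges
  (Mathlib's `Nat.Primes.not_summable_one_div`, Euler 1737).
* Hence `W.LSeries s = 0` (Mathlib's value of a non-summable series) on the closed half-plane
  `re s ≤ 1` (`LSeries_eq_zero_of_re_le_one`), and by the identity theorem `W.LSeries` is analytic
  at `1` only if it vanishes identically near `1`; either way
  `analyticOrderNatAt W.LSeries 1 = 0` (`analyticOrderNatAt_LSeries_one`).
* Consequences for the junk branch: if `L(W, s)` has no entire continuation then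
  `W.analyticRank = 0` (`analyticRank_eq_zero_of_not_hasEntireLFunction`), in particular even, and
  `W.entireLFunction 1 = 0`; contrapositively **`r_an(W) ≠ 0` or `L(W, 1) ≠ 0` each certify the
  entire continuation** (`hasEntireLFunction_of_analyticRank_ne_zero`,
  `hasEntireLFunction_of_entireLFunction_one_ne_zero`) — no modularity input.
* For bsd.S36: the fact is equivalent to its restriction to curves whose `L`-series *has* an entire
  continuation (`even_analyticRank_iff_rootNumber_eq_one_iff_of_hasEntireLFunction`), and follows
  from "entire continuation ⇒ functional equation with some sign"
  (`even_analyticRank_iff_rootNumber_eq_one_of_forall_exists_hasFunctionalEquationSign`). What is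
  left is exactly the case of an elliptic `W / ℚ` with entire `L`-function but no functional
  equation `Λ(2 − s) = ±Λ(s)` at level `N_W` — excluded only by the Modularity Theorem
  (Breuil–Conrad–Diamond–Taylor 2001, Thm. A; tree fact
  `Literature.NumberTheory.EllipticCurves.ModularForms.exists_isNewformOf`) with Carayol's
  level `=` conductor and Hecke's functional equation, as recorded in `BSDRootNumberProofs`.

## References

* J. H. Silverman, *The Arithmetic of Elliptic Curves*, 2nd ed., GTM 106 (2009), C.16 (absolute
  convergence of `L_E(s)` for `re s > 3/2`; Thm. 16.3 and remark, p. 451); Rem. VIII.1.3.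
  [SilvermanAEC2009]
* F. Diamond, J. Shurman, *A First Course in Modular Forms*, GTM 228 (2005), §8.8, (8.44).
  [DiamondShurman2005]
* L. Euler, *Variae observationes circa series infinitas* (1737) — divergence of `∑ 1/p`
  (Mathlib `Mathlib.NumberTheory.SumPrimeReciprocals`).

## Design

Theorems only (no `def`), deliberate dot-notation extensions of Mathlib's `WeierstrassCurve`
namespace for the statements about `W`, as in the sibling proof files; the bsd.S36 reductions live
in `namespace Literature.NumberTheory.EllipticCurves` next to the fact.
-/

noncomputable section

open scoped Classical NumberField

open Complex Filter Topology ArithmeticFunction IsDedekindDomain NumberField Rat.HeightOneSpectrum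

namespace WeierstrassCurve

variable (W : WeierstrassCurve ℚ)

/-! ### The Dirichlet series of `E / ℚ` diverges absolutely at `s = 1` -/

/-- **`a_{p²} = a_p² − p` at a prime of good reduction** (Diamond–Shurman (8.44) with `e = 2`:
`a_{p²} = a_p a_p − 𝟙_E(p) p a_1`, `a_1 = 1`), for Mathlib's `WeierstrassCurve.LFunction` and the
prime `p` under the finite place `v` of `𝓞 ℚ`; the case `k = 0` of the tree's
`WeierstrassCurve.LFunction_apply_prime_pow_add_two`. [cite: DiamondShurman2005, §8.8 (8.44)] -/
theorem LFunction_apply_prime_sq_of_hasGoodReductionAt (v : HeightOneSpectrum (𝓞 ℚ))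
    (hv : W.HasGoodReductionAt v) :
    W.LFunction ((primesEquiv v : ℕ) ^ 2) =
      W.LFunction (primesEquiv v : ℕ) ^ 2 - ((primesEquiv v : ℕ) : ℤ) := by
  have h := W.LFunction_apply_prime_pow_add_two v 0
  simp only [zero_add, pow_one, pow_zero, W.LFunction_apply_one, mul_one, if_pos hv] at h
  rw [h, sq]

/-- At a prime `p` of good reduction, `1/p ≤ |a_p|/p + |a_{p²}|/p²`: since `a_p ∈ ℤ` and
`a_{p²} = a_p² − p`, either `a_p = 0` and the second term is `p/p² = 1/p`, or `|a_p| ≥ 1`.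
(The two terms are the `p`-th and `p²`-th terms of `∑ |aₙ| n⁻¹`.) [folklore] -/
theorem one_div_prime_le_of_hasGoodReductionAt (v : HeightOneSpectrum (𝓞 ℚ))
    (hv : W.HasGoodReductionAt v) :
    (1 : ℝ) / (primesEquiv v : ℕ) ≤
      ‖(W.LFunction (primesEquiv v : ℕ) : ℂ)‖ / (primesEquiv v : ℕ) +
        ‖(W.LFunction ((primesEquiv v : ℕ) ^ 2) : ℂ)‖ / ((primesEquiv v : ℕ) : ℝ) ^ 2 := by
  have hsq := W.LFunction_apply_prime_sq_of_hasGoodReductionAt v hv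
  have hp0 : (0 : ℝ) < (primesEquiv v : ℕ) := Nat.cast_pos.mpr (primesEquiv v).2.pos
  rcases eq_or_ne (W.LFunction (primesEquiv v : ℕ)) 0 with h0 | h0
  · -- `a_p = 0`, `a_{p²} = -p`
    rw [hsq, h0]
    simp only [Int.cast_zero, norm_zero, zero_div, zero_add, ne_eq, OfNat.ofNat_ne_zero,
      not_false_eq_true, zero_pow, zero_sub, Int.cast_neg, Int.cast_natCast, norm_neg,
      Complex.norm_natCast]
    rw [sq, div_mul_cancel_left₀ hp0.ne', one_div]
  · -- `|a_p| ≥ 1`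
    have h1 : (1 : ℝ) ≤ ‖(W.LFunction (primesEquiv v : ℕ) : ℂ)‖ := by
      rw [Complex.norm_intCast]
      exact_mod_cast Int.one_le_abs h0
    calc (1 : ℝ) / (primesEquiv v : ℕ)
        ≤ ‖(W.LFunction (primesEquiv v : ℕ) : ℂ)‖ / (primesEquiv v : ℕ) := by gcongr
      _ ≤ _ := le_add_of_nonneg_right (by positivity)

/-- **The `L`-series of an elliptic curve over `ℚ` does not converge absolutely at `s = 1`.**
For an elliptic `W / ℚ`, `∑ |aₙ(W)| n⁻¹ = ∞` (so Mathlib's `LSeriesSummable`, which is absolute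
summability, fails at `s = 1`): the terms at `n = p, p²` over the primes of good reduction — all but
finitely many (`WeierstrassCurve.finite_badPlaces_holds`; Silverman, *AEC*, Rem. VIII.1.3) — already
dominate `∑_p 1/p`, which diverges (Euler 1737; Mathlib `Nat.Primes.not_summable_one_div`), by
`one_div_prime_le_of_hasGoodReductionAt`. (The abscissa of absolute convergence of `L(E, s)` is in
fact `3/2`; Silverman, *AEC*, C.16. Only the elementary bound `≥ 1` is proved here.) [folklore] -/
theorem not_LSeriesSummable_LFunction_one [W.IsElliptic] :
    ¬ LSeriesSummable ((↑) ∘ W.LFunction : ℕ → ℂ) 1 := by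
  intro hsum
  set f : ℕ → ℂ := ((↑) ∘ W.LFunction : ℕ → ℂ) with hf
  have hg : Summable fun n ↦ ‖LSeries.term f 1 n‖ := summable_norm_iff.mpr hsum
  have hg' : ∀ n : ℕ, n ≠ 0 → ‖LSeries.term f 1 n‖ = ‖(W.LFunction n : ℂ)‖ / n := fun n hn ↦ by
    rw [LSeries.norm_term_eq, if_neg hn, Complex.one_re, Real.rpow_one]
    rfl
  -- the sub-sums over `n = p_v` and `n = p_v ^ 2`, indexed by the finite places `v` of `𝓞 ℚ`
  set P : HeightOneSpectrum (𝓞 ℚ) → ℕ := fun v ↦ (primesEquiv v : ℕ) with hP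
  have hPinj : Function.Injective P := fun v w h ↦ primesEquiv.injective (Subtype.ext h)
  have hP2inj : Function.Injective fun v ↦ P v ^ 2 := fun v w h ↦
    hPinj (Nat.pow_left_injective two_ne_zero h)
  have h1 : Summable fun v ↦ ‖LSeries.term f 1 (P v)‖ := hg.comp_injective hPinj
  have h2 : Summable fun v ↦ ‖LSeries.term f 1 (P v ^ 2)‖ := hg.comp_injective hP2inj
  have h12 := h1.add h2
  -- good reduction at all but finitely many places
  have hgood : ∀ᶠ v : HeightOneSpectrum (𝓞 ℚ) in cofinite, W.HasGoodReductionAt v := by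
    rw [Filter.eventually_cofinite]
    exact W.finite_badPlaces_holds (𝓞 ℚ)
  -- comparison: `∑_v 1 / p_v` converges
  have hinv : Summable fun v : HeightOneSpectrum (𝓞 ℚ) ↦ (1 : ℝ) / (P v : ℝ) := by
    refine Summable.of_norm_bounded_eventually h12 ?_
    filter_upwards [hgood] with v hv
    have hPv : P v ≠ 0 := (primesEquiv v).2.ne_zero
    rw [Real.norm_of_nonneg (by positivity), hg' _ hPv, hg' _ (pow_ne_zero 2 hPv), Nat.cast_pow]
    exact W.one_div_prime_le_of_hasGoodReductionAt v hv
  -- transport along `primesEquiv : HeightOneSpectrum (𝓞 ℚ) ≃ Nat.Primes` and conclude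
  have hprimes : Summable fun p : Nat.Primes ↦ (1 : ℝ) / p :=
    (primesEquiv (R := 𝓞 ℚ)).summable_iff.mp hinv
  exact Nat.Primes.not_summable_one_div hprimes

/-- The `L`-series of an elliptic `W / ℚ` does not converge absolutely at any `s` with `re s ≤ 1`
(monotonicity of absolute convergence in `re s`, Mathlib `LSeriesSummable.of_re_le_re`, and
`not_LSeriesSummable_LFunction_one`). [folklore] -/
theorem not_LSeriesSummable_LFunction_of_re_le_one [W.IsElliptic] {s : ℂ} (hs : s.re ≤ 1) :
    ¬ LSeriesSummable ((↑) ∘ W.LFunction : ℕ → ℂ) s :=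
  fun h ↦ W.not_LSeriesSummable_LFunction_one (h.of_re_le_re (by rwa [Complex.one_re]))

/-- The abscissa of absolute convergence of `L(E/ℚ, s) = ∑ aₙ n⁻ˢ` is at least `1` (elementary
lower bound; the true value is `3/2`, Silverman, *AEC*, C.16). [folklore] -/
theorem one_le_abscissaOfAbsConv_LFunction [W.IsElliptic] :
    1 ≤ LSeries.abscissaOfAbsConv ((↑) ∘ W.LFunction : ℕ → ℂ) := by
  by_contra h
  push Not at h
  refine W.not_LSeriesSummable_LFunction_one (LSeriesSummable_of_abscissaOfAbsConv_lt_re ?_)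
  simpa using h

/-- On the closed half-plane `re s ≤ 1`, Mathlib's `W.LSeries s` takes the value `0` for an elliptic
`W / ℚ` — the conventional value of a non-summable series (`LSeries.eq_zero_of_not_LSeriesSummable`),
the series being absolutely divergent there (`not_LSeriesSummable_LFunction_of_re_le_one`). A
statement about Mathlib's junk convention, not about `L(E, s)`. [folklore] -/
theorem LSeries_eq_zero_of_re_le_one [W.IsElliptic] {s : ℂ} (hs : s.re ≤ 1) : W.LSeries s = 0 :=
  LSeries.eq_zero_of_not_LSeriesSummable _ _ (W.not_LSeriesSummable_LFunction_of_re_le_one hs)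

/-- For an elliptic `W / ℚ`, the order of vanishing at `s = 1` of the *series* `W.LSeries`
(as a function on `ℂ` with Mathlib's conventions) is `0`: `W.LSeries` vanishes on the open set
`re s < 1` (`LSeries_eq_zero_of_re_le_one`), so if it is analytic at `1` it vanishes identically on
a ball around `1` by the identity theorem (Mathlib
`AnalyticOnNhd.eqOn_zero_of_preconnected_of_eventuallyEq_zero`), and its order is `⊤`, read as
`0` in `ℕ`; if it is not analytic at `1` the order is `0` by convention. [folklore] -/
theorem analyticOrderNatAt_LSeries_one [W.IsElliptic] : analyticOrderNatAt W.LSeries 1 = 0 := by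
  by_cases han : AnalyticAt ℂ W.LSeries 1
  · have hzero : ∀ᶠ z in 𝓝 (1 : ℂ), W.LSeries z = 0 := by
      obtain ⟨r, hr, hball⟩ := han.exists_ball_analyticOnNhd
      have hz₀ : ((1 - r / 2 : ℝ) : ℂ) ∈ Metric.ball (1 : ℂ) r := by
        rw [Metric.mem_ball, Complex.dist_eq,
          show ((1 - r / 2 : ℝ) : ℂ) - 1 = ((-(r / 2) : ℝ) : ℂ) by push_cast; ring,
          Complex.norm_real, Real.norm_eq_abs, abs_neg, abs_of_pos (by positivity)]
        linarith
      have hev : W.LSeries =ᶠ[𝓝 ((1 - r / 2 : ℝ) : ℂ)] 0 := by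
        have hopen : IsOpen {s : ℂ | s.re < 1} := isOpen_lt Complex.continuous_re continuous_const
        filter_upwards [hopen.mem_nhds (show ((1 - r / 2 : ℝ) : ℂ).re < 1 by
          rw [Complex.ofReal_re]; linarith)] with s hs
        exact W.LSeries_eq_zero_of_re_le_one (le_of_lt hs)
      have heq := hball.eqOn_zero_of_preconnected_of_eventuallyEq_zero
        (convex_ball (1 : ℂ) r).isPreconnected hz₀ hev
      filter_upwards [Metric.ball_mem_nhds (1 : ℂ) hr] with z hz
      exact heq hz
    have htop : analyticOrderAt W.LSeries 1 = ⊤ := analyticOrderAt_eq_top.mpr hzero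
    simp [analyticOrderNatAt, htop]
  · exact analyticOrderNatAt_of_not_analyticAt han

/-! ### The junk branch of the analytic rank -/

/-- **No continuation ⇒ analytic rank `0`.** If the `L`-series of an elliptic `W / ℚ` has no entire
continuation, the tree's `W.entireLFunction` is the series `W.LSeries` itself (documented junk
value of `Literature.NumberTheory.EllipticCurves.AnalyticRank`), whose order at `1` is `0`
(`analyticOrderNatAt_LSeries_one`); so `W.analyticRank = 0`. [folklore] -/
theorem analyticRank_eq_zero_of_not_hasEntireLFunction [W.IsElliptic] (h : ¬ W.HasEntireLFunction) :
    W.analyticRank = 0 := by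
  have h' : ¬ (entireContinuations W).Nonempty := h
  have hL : W.entireLFunction = W.LSeries := by
    unfold entireLFunction
    rw [dif_neg h']
  unfold analyticRank
  rw [hL]
  exact W.analyticOrderNatAt_LSeries_one

/-- No continuation ⇒ the analytic rank (then a junk value) is even, namely `0`
(`analyticRank_eq_zero_of_not_hasEntireLFunction`). [folklore] -/
theorem even_analyticRank_of_not_hasEntireLFunction [W.IsElliptic] (h : ¬ W.HasEntireLFunction) :
    Even W.analyticRank := by
  rw [W.analyticRank_eq_zero_of_not_hasEntireLFunction h]
  exact ⟨0, rfl⟩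

/-- No continuation ⇒ `W.entireLFunction 1 = 0` for an elliptic `W / ℚ` (the junk
`W.entireLFunction = W.LSeries` vanishes on `re s ≤ 1`, `LSeries_eq_zero_of_re_le_one`). [folklore] -/
theorem entireLFunction_one_eq_zero_of_not_hasEntireLFunction [W.IsElliptic]
    (h : ¬ W.HasEntireLFunction) : W.entireLFunction 1 = 0 := by
  have h' : ¬ (entireContinuations W).Nonempty := h
  unfold entireLFunction
  rw [dif_neg h']
  exact W.LSeries_eq_zero_of_re_le_one (by rw [Complex.one_re])

/-- **Positive analytic rank certifies the continuation.** For an elliptic `W / ℚ`, if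
`W.analyticRank ≠ 0` then `L(W, s)` has an entire continuation — unconditionally, by
`analyticRank_eq_zero_of_not_hasEntireLFunction` (in the junk branch the rank is `0`). [folklore] -/
theorem hasEntireLFunction_of_analyticRank_ne_zero [W.IsElliptic] (h : W.analyticRank ≠ 0) :
    W.HasEntireLFunction := by
  by_contra hE
  exact h (W.analyticRank_eq_zero_of_not_hasEntireLFunction hE)

/-- **`L(W, 1) ≠ 0` certifies the continuation.** For an elliptic `W / ℚ`, if the tree's value
`W.entireLFunction 1` is non-zero then `L(W, s)` has an entire continuation — unconditionally, by
`entireLFunction_one_eq_zero_of_not_hasEntireLFunction`. So hypotheses of the form `L(E, 1) ≠ 0`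
(bsd.S28 and its leaves) never concern the junk branch. [folklore] -/
theorem hasEntireLFunction_of_entireLFunction_one_ne_zero [W.IsElliptic]
    (h : W.entireLFunction 1 ≠ 0) : W.HasEntireLFunction := by
  by_contra hE
  exact h (W.entireLFunction_one_eq_zero_of_not_hasEntireLFunction hE)

end WeierstrassCurve

namespace Literature.NumberTheory.EllipticCurves

variable (W : WeierstrassCurve ℚ)

/-- **Where modularity enters, sharpened.** The fact `even_analyticRank_iff_rootNumber_eq_one W`
is equivalent to its implication `w(W) = 1 ⇒ ord_{s=1} L(W, s)` even *for curves whose `L`-series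
has an entire continuation*: the implication `⇒` is unconditional
(`WeierstrassCurve.rootNumber_eq_one_of_even_analyticRank`), and without a continuation the analytic
rank is the junk value `0` (`WeierstrassCurve.even_analyticRank_of_not_hasEntireLFunction`). The
remaining case — entire `L`-function, no functional equation of sign `−1` — is where the Modularity
Theorem (Breuil–Conrad–Diamond–Taylor 2001, Thm. A) is needed (Silverman, *AEC*, C.16, Thm. 16.3 and
remark, p. 451). [cite: SilvermanAEC2009, C.16 Thm. 16.3 and remark, p. 451] -/
theorem even_analyticRank_iff_rootNumber_eq_one_iff_of_hasEntireLFunction :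
    even_analyticRank_iff_rootNumber_eq_one W ↔
      ∀ [W.IsElliptic], W.HasEntireLFunction → W.rootNumber = 1 → Even W.analyticRank := by
  rw [even_analyticRank_iff_rootNumber_eq_one_iff]
  constructor
  · intro h _ _ h1
    exact h h1
  · intro h _ h1
    by_cases hE : W.HasEntireLFunction
    · exact h hE h1
    · exact W.even_analyticRank_of_not_hasEntireLFunction hE

/-- The fact `even_analyticRank_iff_rootNumber_eq_one W` from "**entire continuation ⇒ functional
equation with some sign**" for `W`: if `W.HasEntireLFunction` implies `Λ(W, 2 − s) = ε Λ(W, s)` for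
some `ε` (as the Modularity Theorem guarantees for every elliptic `W / ℚ`; Silverman, *AEC*, C.16,
Thm. 16.3), then parity holds (`WeierstrassCurve.even_analyticRank_iff_rootNumber_eq_one_of_exists`
in the continuation branch, `WeierstrassCurve.even_analyticRank_of_not_hasEntireLFunction` in the
junk branch). A reduction, not a discharge. [cite: SilvermanAEC2009, C.16 Thm. 16.3 and remark, p. 451] -/
theorem even_analyticRank_iff_rootNumber_eq_one_of_forall_exists_hasFunctionalEquationSign
    (h : ∀ [W.IsElliptic], W.HasEntireLFunction → ∃ ε : ℤ, W.HasFunctionalEquationSign ε) :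
    even_analyticRank_iff_rootNumber_eq_one W := by
  rw [even_analyticRank_iff_rootNumber_eq_one_iff_of_hasEntireLFunction]
  intro _ hE h1
  exact (WeierstrassCurve.even_analyticRank_iff_rootNumber_eq_one_of_exists (h hE)).mpr h1

end Literature.NumberTheory.EllipticCurves

end
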